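import Literature.AlgebraicGeometry.Resolution.DerivativeIdealsSupport
import Mathlib.RingTheory.Localization.Submodule
import Mathlib.RingTheory.Nilpotent.Lemmas
import Mathlib.Data.ZMod.Basic
import HarnessLib

/-!
# `HasLocalCoordinates`: the discharge in the generality of BGMW §3.5, and why it is a hypothesis

Topic: `Literature/AlgebraicGeometry/Resolution`. Sibling proof file of
`DerivativeIdealsSupport.lean` (proofs only, no new notions), concerning its predicate

  `HasLocalCoordinates (φ : k →+* Γ(X, 𝒪_X)) : Prop` — every local ring `𝒪_{X,x}` carries a minimal
  system of generators `u₁, …, u_d` of `𝔪_x` with dual `k`-derivations `δᵢ(uⱼ) = δᵢⱼ`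
  (`CoordSystem`),

the tree's rendering of Bierstone–Grigoriev–Milman–Włodarczyk, *Effective Hironaka resolution and
its complexity*, arXiv:1206.3090, §3.5: "Recall that on a smooth variety `X` there is a locally
free sheaf of differentials `Ω_{X/K}` over `K` generated locally by `du₁, …, du_n` for a set of
local parameters `u₁, …, u_n`. The dual sheaf of derivations `Der_K(𝒪_X)` is locally generated
by the derivations `∂/∂uᵢ`" (standing hypotheses of §3: `X` a smooth variety over an algebraically
closed field `K`; §2: characteristic zero "is only needed for the local existence of a
hypersurface of maximal contact").

`HasLocalCoordinates` is a PREDICATE on a `k`-structure `φ` (exactly like its companion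
`HasFinitePresentationDifferentials φ`), used as an explicit hypothesis by
`MarkedIdeal.support_deriv_eq` & co.; it is not a closed statement, and its closure over all
`k`-structures is FALSE (below). What the source asserts is the predicate UNDER ITS HYPOTHESES —
`X` smooth over the field — and that is a theorem of the tree: `hasLocalCoordinates_overHom`
(`DerivativeIdealsSupport.lean`: `X` smooth over `Spec k`, `k` perfect — in particular algebraically
closed —, at every point, closed or not). This file records:

* `HasLocalCoordinates_holds` — **the discharge in the source's generality, local form**: for ANY
  `k`-structure `φ` on a scheme `X` over a perfect field `k` such that every local ring `𝒪_{X,x}`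
  is essentially of finite type and formally smooth over `k` (i.e. `X` is smooth over `k` at every
  point), `HasLocalCoordinates φ` holds (from `nonempty_coordSystem_of_perfectField`,
  `SmoothCoordinates.lean`, i.e. Matsumura Thm. 30.6 (ii)); `hasLocalCoordinates_overHom` is the
  case `φ = overHom k X`, `Smooth (X ↘ Spec k)` (it is literally
  `HasLocalCoordinates_holds (overHom k X) (essFiniteType_stalk_overHom k X)
  (formallySmooth_stalk_overHom k X)`).
* **Why it is only a hypothesis** (the obstruction, [folklore]): the dual derivations kill `ℕ` and
  the image of `k`, so by the Euler congruence `Σ uᵢ δᵢ(a) ≡ a (mod 𝔪²)` every natural number (or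
  scalar) lying in `𝔪_x` lies in `𝔪_x²` (`CoordSystem.natCast_mem_sq`,
  `HasLocalCoordinates.natCast_mem_maximalIdeal_sq`) — so no unramified local ring of mixed
  characteristic (`p ∈ 𝔪 ∖ 𝔪²`, e.g. `ℤ_(p) = 𝒪_{Spec ℤ,(p)}` over `ℤ`) has local coordinates with
  dual derivations; and when every germ is a natural-number cast every derivation of the local
  ring vanishes outright (`derivation_eq_zero_of_natCast_surjective`), whence
* `not_hasLocalCoordinates_specZModFour` — **a scheme without local coordinates**: the fat point
  `Spec (ℤ/4)` admits NO `k`-structure `φ` (over any `k`) with `HasLocalCoordinates φ` (its local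
  ring is `ℤ/4 = {0, 1, 2, 3}`, all casts, with `𝔪 = (2) ≠ 0`); hence
  `not_forall_hasLocalCoordinates : ¬ ∀ k X φ, HasLocalCoordinates φ`.

Faithfulness: nothing of BGMW is restated or weakened; `HasLocalCoordinates` keeps its meaning and
the discharge carries exactly the smoothness hypothesis under which §3.5 asserts it.

## Sources

* [BGMW 2011] E. Bierstone, D. Grigoriev, P. Milman, J. Włodarczyk, arXiv:1206.3090, §3.5 (with §2
  p. 5 and the standing hypothesis of §3). [BierstoneGrigorievMilmanWlodarczyk2011]
* H. Matsumura, *Commutative Ring Theory* (1986), Thm. 30.6 (ii) — through `SmoothCoordinates.lean`.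
  [Matsumura1987]
-/

namespace Literature.AlgebraicGeometry.Resolution

open CategoryTheory _root_.AlgebraicGeometry TopologicalSpace IsLocalRing Opposite

universe u v w

/-! ## Ring level: what the dual derivations kill lies in `𝔪²` -/

namespace CoordSystem

variable {R : Type u} {A : Type v} [CommSemiring R] [CommRing A] [Algebra R A] {𝔪 : Ideal A}
  {ι : Type w} [Fintype ι]

/-- If `a ∈ 𝔪` is killed by all the dual derivations `δᵢ` of a coordinate system for `𝔪`, then
`a ∈ 𝔪²` — by the Euler congruence `Σᵢ uᵢ δᵢ(a) ≡ a (mod 𝔪²)` (`euler_sub_mem_sq`). [folklore] -/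
theorem mem_sq_of_forall_deriv_eq_zero (c : CoordSystem R 𝔪 ι) {a : A} (ha : a ∈ 𝔪)
    (h : ∀ i, c.deriv i a = 0) : a ∈ 𝔪 ^ 2 := by
  have := c.euler_sub_mem_sq ha
  simp only [h, mul_zero, Finset.sum_const_zero, zero_sub] at this
  exact neg_mem_iff.mp this

/-- Scalars from the base ring that lie in `𝔪` lie in `𝔪²` (derivations over `R` kill `R`).
[folklore] -/
theorem algebraMap_mem_sq (c : CoordSystem R 𝔪 ι) {r : R} (hr : algebraMap R A r ∈ 𝔪) :
    algebraMap R A r ∈ 𝔪 ^ 2 :=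
  c.mem_sq_of_forall_deriv_eq_zero hr fun i => (c.deriv i).map_algebraMap r

/-- Natural numbers that lie in `𝔪` lie in `𝔪²` (derivations kill `ℕ`): so NO coordinate system
with dual derivations exists for the maximal ideal of a local ring in which some prime number
`p ∈ 𝔪 ∖ 𝔪²` (e.g. `ℤ_(p)`, `ℤ/p²`, any unramified regular local ring of mixed characteristic).
[folklore] -/
theorem natCast_mem_sq (c : CoordSystem R 𝔪 ι) {n : ℕ} (hn : (n : A) ∈ 𝔪) : (n : A) ∈ 𝔪 ^ 2 :=
  c.mem_sq_of_forall_deriv_eq_zero hn fun i => (c.deriv i).map_natCast n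

end CoordSystem

/-- If every element of the algebra `A` is a natural-number cast (e.g. `A = ℤ/n`), every
derivation of `A` (over any base, into any module) vanishes. [folklore] -/
theorem derivation_eq_zero_of_natCast_surjective {R : Type u} {A : Type v} {M : Type w}
    [CommSemiring R] [CommRing A] [Algebra R A] [AddCommGroup M] [Module A M] [Module R M]
    (h : ∀ a : A, ∃ n : ℕ, (n : A) = a) (δ : Derivation R A M) : δ = 0 := by
  ext a
  obtain ⟨n, rfl⟩ := h a
  rw [Derivation.map_natCast, Derivation.zero_apply]

/-! ## Scheme level -/

section Local

variable {k : Type v} [CommRing k] {X : Scheme.{u}} {φ : k →+* Γ(X, ⊤)}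

/-- **The obstruction**: if the `k`-scheme `X` has local coordinates with dual derivations at every
point, then at every point every natural number lying in `𝔪_x` lies in `𝔪_x²`; so e.g. `Spec ℤ`,
`Spec ℤ_(p)`, `Spec ℤ/p²` carry no `k`-structure with local coordinates. [folklore] -/
theorem HasLocalCoordinates.natCast_mem_maximalIdeal_sq (hc : HasLocalCoordinates φ) (x : X)
    {n : ℕ} (hn : (n : X.presheaf.stalk x) ∈ maximalIdeal (X.presheaf.stalk x)) :
    (n : X.presheaf.stalk x) ∈ maximalIdeal (X.presheaf.stalk x) ^ 2 := by
  letI := stalkAlgebra φ x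
  obtain ⟨c⟩ := hc x
  exact c.natCast_mem_sq hn

/-- Likewise for the scalars: the image of `r ∈ k` in `𝒪_{X,x}` lies in `𝔪_x²` as soon as it lies
in `𝔪_x`. [folklore] -/
theorem HasLocalCoordinates.stalkHom_mem_maximalIdeal_sq (hc : HasLocalCoordinates φ) (x : X)
    {r : k} (hr : stalkHom φ x r ∈ maximalIdeal (X.presheaf.stalk x)) :
    stalkHom φ x r ∈ maximalIdeal (X.presheaf.stalk x) ^ 2 := by
  letI := stalkAlgebra φ x
  obtain ⟨c⟩ := hc x
  exact c.algebraMap_mem_sq hr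

/-- At a point of an affine open `U` all of whose sections are units or nilpotent (`Γ(X, U)` a
zero-dimensional local ring, e.g. `X = U = Spec ℤ/p^n`), the germ map `Γ(X, U) → 𝒪_{X,x}` is
surjective: `𝒪_{X,x}` is the localization of `Γ(X, U)` at a prime, whose complement consists of
units. [folklore] -/
theorem germ_surjective_of_isUnit_or_isNilpotent {U : X.Opens} (hU : IsAffineOpen U)
    (h : ∀ s : Γ(X, U), IsUnit s ∨ IsNilpotent s) (x : X) (hx : x ∈ U) :
    Function.Surjective (X.presheaf.germ U x hx).hom := by
  letI := TopCat.Presheaf.algebra_section_stalk X.presheaf (⟨x, hx⟩ : U)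
  haveI := hU.isLocalization_stalk ⟨x, hx⟩
  intro a
  obtain ⟨⟨s, m⟩, hsm⟩ :=
    IsLocalization.surj (hU.primeIdealOf ⟨x, hx⟩).asIdeal.primeCompl (S := X.presheaf.stalk x) a
  have hm : IsUnit (m : Γ(X, U)) := by
    rcases h m with hu | hnil
    · exact hu
    · exact absurd (nilradical_le_prime (hU.primeIdealOf ⟨x, hx⟩).asIdeal (mem_nilradical.mpr hnil))
        (Ideal.mem_primeCompl_iff.mp m.2)
  refine ⟨s * ↑hm.unit⁻¹, ?_⟩
  change algebraMap Γ(X, U) (X.presheaf.stalk x) (s * ↑hm.unit⁻¹) = a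
  have ha : a = algebraMap Γ(X, U) (X.presheaf.stalk x) s *
      algebraMap Γ(X, U) (X.presheaf.stalk x) ↑hm.unit⁻¹ := by
    rw [← hsm, mul_assoc, ← map_mul, IsUnit.mul_val_inv, map_one, mul_one]
  rw [ha, map_mul]

/-- Hence, if moreover every section over `U` is a natural-number cast, so is every germ at `x`,
and **every derivation of `𝒪_{X,x}` vanishes** (over any base). [folklore] -/
theorem derivation_stalk_eq_zero {U : X.Opens} (hU : IsAffineOpen U)
    (h : ∀ s : Γ(X, U), IsUnit s ∨ IsNilpotent s) (hℕ : ∀ s : Γ(X, U), ∃ n : ℕ, (n : Γ(X, U)) = s)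
    (x : X) (hx : x ∈ U) {R : Type w} [CommSemiring R] [Algebra R (X.presheaf.stalk x)]
    (δ : Derivation R (X.presheaf.stalk x) (X.presheaf.stalk x)) : δ = 0 := by
  refine derivation_eq_zero_of_natCast_surjective (fun a => ?_) δ
  obtain ⟨s, rfl⟩ := germ_surjective_of_isUnit_or_isNilpotent hU h x hx a
  obtain ⟨n, rfl⟩ := hℕ s
  exact ⟨n, (map_natCast (X.presheaf.germ U x hx).hom n).symm⟩

/-- **No local coordinates at a fat point**: if some affine open `U ∋ x` has all its sections
natural-number casts that are units or nilpotent, and `𝒪_{X,x}` is not a field, then no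
`k`-structure `φ` on `X` has `HasLocalCoordinates φ` (all derivations of `𝒪_{X,x}` vanish, while a
coordinate system needs `δ₁(u₁) = 1` as soon as `𝔪_x ≠ 0`). [folklore] -/
theorem not_hasLocalCoordinates_of_natCast_surjective (φ : k →+* Γ(X, ⊤)) {U : X.Opens}
    (hU : IsAffineOpen U) (h : ∀ s : Γ(X, U), IsUnit s ∨ IsNilpotent s)
    (hℕ : ∀ s : Γ(X, U), ∃ n : ℕ, (n : Γ(X, U)) = s) {x : X} (hx : x ∈ U)
    (h𝔪 : maximalIdeal (X.presheaf.stalk x) ≠ ⊥) : ¬HasLocalCoordinates φ := by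
  intro hc
  letI := stalkAlgebra φ x
  obtain ⟨c⟩ := hc x
  rcases isEmpty_or_nonempty (Fin (maximalIdeal (X.presheaf.stalk x)).spanFinrank) with he | ⟨⟨i⟩⟩
  · apply h𝔪
    rw [← c.span_range_coord, Set.range_eq_empty, Ideal.span_empty]
  · have h1 := c.deriv_coord_self i
    rw [derivation_stalk_eq_zero hU h hℕ x hx (c.deriv i), Derivation.zero_apply] at h1
    exact zero_ne_one h1

end Local

/-! ## The discharge in the generality of the source -/

section Discharge

/-- **BGMW §3.5, "`Der_K(𝒪_X)` is locally generated by the derivations `∂/∂uᵢ`" — the discharge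
of `HasLocalCoordinates` in the generality in which the source asserts it** (a smooth variety over
a field; here: any scheme `X` with a `k`-structure `φ` over a PERFECT field `k` such that every
local ring `𝒪_{X,x}` is essentially of finite type and formally smooth over `k`, i.e. `X` smooth
over `k` at every point, closed or not): every `𝒪_{X,x}` carries a minimal system of generators of
`𝔪_x` with dual `k`-derivations. (`HasLocalCoordinates` is a predicate on `φ`, not a closed
statement — its closure over all `φ` is false, `not_forall_hasLocalCoordinates`; this is its
`_holds` form. Proof: `nonempty_coordSystem_of_perfectField`, i.e. Matsumura Thm. 30.6 (ii) via
the Jacobian criterion.) [cite: BierstoneGrigorievMilmanWlodarczyk2011, §3.5] -/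
theorem HasLocalCoordinates_holds {k : Type v} [Field k] [PerfectField k] {X : Scheme.{u}}
    (φ : k →+* Γ(X, ⊤))
    (hfin : ∀ x : X, letI := stalkAlgebra φ x; Algebra.EssFiniteType k (X.presheaf.stalk x))
    (hsm : ∀ x : X, letI := stalkAlgebra φ x; Algebra.FormallySmooth k (X.presheaf.stalk x)) :
    HasLocalCoordinates φ := by
  intro x
  letI := stalkAlgebra φ x
  haveI := hfin x
  haveI := hsm x
  haveI : IsNoetherianRing (X.presheaf.stalk x) :=
    Algebra.EssFiniteType.isNoetherianRing k (X.presheaf.stalk x)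
  exact nonempty_coordSystem_of_perfectField

end Discharge

/-! ## A scheme with no local coordinates: the fat point `Spec ℤ/4` -/

section Counterexample

/-- Every element of `ℤ/4 = {0, 1, 2, 3}` is a unit (`1`, `3`) or nilpotent (`0`, `2`).
[folklore] -/
theorem isUnit_or_isNilpotent_zmod_four (r : ZMod 4) : IsUnit r ∨ IsNilpotent r := by
  fin_cases r
  · exact Or.inr IsNilpotent.zero
  · exact Or.inl isUnit_one
  · exact Or.inr ⟨2, by decide⟩
  · exact Or.inl (IsUnit.of_mul_eq_one 3 (by decide))

/-- **`Spec ℤ/4` has no local coordinates with dual derivations, for any `k`-structure**: its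
local ring at the unique point is `ℤ/4`, every element of which is a natural number, so every
derivation vanishes, while `𝔪 = (2) ≠ 0` (`2 ≠ 0`, `2² = 0`). [folklore] -/
theorem not_hasLocalCoordinates_specZModFour {k : Type v} [CommRing k]
    (φ : k →+* Γ(Spec (.of (ZMod 4)), ⊤)) : ¬HasLocalCoordinates φ := by
  let X : Scheme.{0} := Spec (.of (ZMod 4))
  -- `Γ(X, ⊤) ≅ ℤ/4`
  let e : ZMod 4 ≃+* Γ(X, ⊤) := (Scheme.ΓSpecIso (.of (ZMod 4))).commRingCatIsoToRingEquiv.symm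
  have hΓ : ∀ s : Γ(X, ⊤), ∃ r : ZMod 4, e r = s := e.surjective
  have h : ∀ s : Γ(X, ⊤), IsUnit s ∨ IsNilpotent s := by
    intro s
    obtain ⟨r, rfl⟩ := hΓ s
    exact (isUnit_or_isNilpotent_zmod_four r).imp (fun hu => hu.map e) fun hn => hn.map e
  have hℕ : ∀ s : Γ(X, ⊤), ∃ n : ℕ, (n : Γ(X, ⊤)) = s := by
    intro s
    obtain ⟨r, rfl⟩ := hΓ s
    exact ⟨r.val, by rw [← map_natCast e, ZMod.natCast_zmod_val]⟩
  -- the (unique) point and its local ring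
  haveI : Nontrivial (ZMod 4) := ⟨⟨0, 1, by decide⟩⟩
  let x : X := Classical.arbitrary (PrimeSpectrum (ZMod 4))
  have hU : IsAffineOpen (⊤ : X.Opens) := isAffineOpen_top X
  have hx : x ∈ (⊤ : X.Opens) := trivial
  refine not_hasLocalCoordinates_of_natCast_surjective φ hU h hℕ hx ?_
  -- `𝔪_x ≠ 0`: the germ of `2` is a nonzero non-unit
  letI := TopCat.Presheaf.algebra_section_stalk X.presheaf (⟨x, hx⟩ : (⊤ : X.Opens))
  haveI := hU.isLocalization_stalk ⟨x, hx⟩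
  have h4 : ((4 : ℕ) : X.presheaf.stalk x) = 0 := by
    rw [← map_natCast (algebraMap Γ(X, ⊤) (X.presheaf.stalk x)), ← map_natCast e,
      ZMod.natCast_self, map_zero, map_zero]
  have h2mem : ((2 : ℕ) : X.presheaf.stalk x) ∈ maximalIdeal (X.presheaf.stalk x) := by
    rw [mem_maximalIdeal, mem_nonunits_iff]
    intro hu
    have hsq : ((2 : ℕ) : X.presheaf.stalk x) ^ 2 = 0 := by
      rw [← Nat.cast_pow]
      exact h4
    exact (hu.pow 2).ne_zero hsq
  have h2ne : ((2 : ℕ) : X.presheaf.stalk x) ≠ 0 := by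
    intro h0
    rw [← map_natCast (algebraMap Γ(X, ⊤) (X.presheaf.stalk x)),
      IsLocalization.map_eq_zero_iff (hU.primeIdealOf ⟨x, hx⟩).asIdeal.primeCompl
        (X.presheaf.stalk x)] at h0
    obtain ⟨m, hm⟩ := h0
    have hmu : IsUnit (m : Γ(X, ⊤)) := by
      rcases h m with hu | hnil
      · exact hu
      · exact absurd (nilradical_le_prime (hU.primeIdealOf ⟨x, hx⟩).asIdeal
          (mem_nilradical.mpr hnil)) (Ideal.mem_primeCompl_iff.mp m.2)
    have h2Γ : ((2 : ℕ) : Γ(X, ⊤)) = 0 := hmu.mul_right_eq_zero.mp hm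
    have h2R : ((2 : ℕ) : ZMod 4) = 0 := by
      apply e.injective
      rw [map_natCast, map_zero, h2Γ]
    exact absurd h2R (by decide)
  intro hbot
  rw [hbot, Ideal.mem_bot] at h2mem
  exact h2ne h2mem

/-- Hence **`HasLocalCoordinates` is a genuine hypothesis, not a theorem**: it fails for some
`k`-structure on some scheme (e.g. `Spec ℤ/4` with its own global sections as `k`).
[folklore] -/
theorem not_forall_hasLocalCoordinates :
    ¬∀ (k : Type) [CommRing k] (X : Scheme.{0}) (φ : k →+* Γ(X, ⊤)), HasLocalCoordinates φ :=
  fun h => not_hasLocalCoordinates_specZModFour (RingHom.id _) (h _ _ _)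

end Counterexample

end Literature.AlgebraicGeometry.Resolution
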